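import Summits.Ventures.Crystal3D.Theorems.StickyWulffConstantGenericWallFloorSigma9FullDown
import Summits.Ventures.Crystal3D.Theorems.StickyWulffConstantGenericWallFloorInPlaneTwinStarPairHolds
import HarnessLib

/-!
# `GenericWallFloor` at FULL charge on the one-sided `Σ9` classes, modulo the two CERTIFIED computations only
# (crux `GenericWallFloor`, stmt-Ventures-19480, line `WallLedgerG`)

HONEST FRAMING. Venture `Summits/Ventures/Crystal3D` (cell `crystal3d-full`), helper `--supports` the crux
`GenericWallFloor` of `route-Ventures-StickyWulffConstant`, REGISTERED line `WallLedgerG`, open stub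
`stub_twoSlabAdhesion`.  Rung credit only; F-C1 not moved; NOT the crux: the inputs `ExactOnly`(C12-55) [E1] and
`StarPairFar` [certified ×2] remain BY NAME; the third input of `…Sigma9Full` / `…Sigma9FullDown`,
`InPlaneTwinStarPair`, is DISCHARGED here by `inPlaneTwinStarPair_holds` (`…InPlaneTwinStarPairHolds`).

* `genericWallFloorAtCharge_one_sigma9` / `genericWallFloorAtCharge_one_sigma9Down` — the crux's matrix at `c₀ = 1`,
  verbatim, for every `Σ9` pair with a steep slot of one grain IN its composition plane and the other grain's lamella
  capper in that plane (both readings `hsecond`/`hcap` of the level-two condition), modulo `ExactOnly`(C12-55) and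
  `StarPairFar` — numerically `≈ 83 %` of Haar `Σ9` orientations (two-sided word criterion before: `38 %`).
WHAT THIS IS NOT: not the stub; the remaining `Σ9` core (mutual arrival; both grains one-sided only through the
lamella capper) and `E1`/`StarPairFar` themselves are untouched; F-C1 not moved.
-/

noncomputable section

namespace Summit.Ventures.Crystal3D.Theorems

open Summit.Ventures.Crystal3D Finset
open Literature.MathematicalPhysics.StatisticalMechanics (fccStacking barlowStacking IsHaggSeq contactDeficiency)
open scoped InnerProductSpace

open scoped Classical in
/-- **`GenericWallFloor` per pair at FULL charge on the one-sided `Σ9` class (lower grain in-plane)**, modulo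
`ExactOnly`(C12-55) and `StarPairFar` only. -/
theorem genericWallFloorAtCharge_one_sigma9
    {s₀ : EuclideanSpace ℝ (Fin 3)} (hs₀ : s₀ ∈ fccSlots)
    (hcert : ExactOnly 0 (fccSlots.filter fun w => 0 < ⟪w, s₀⟫_ℝ)) (hfar : StarPairFar)
    (A₁ : EuclideanSpace ℝ (Fin 3) ≃ₗᵢ[ℝ] EuclideanSpace ℝ (Fin 3)) (t₁ : EuclideanSpace ℝ (Fin 3))
    (A₂ : EuclideanSpace ℝ (Fin 3) ≃ₗᵢ[ℝ] EuclideanSpace ℝ (Fin 3)) (t₂ : EuclideanSpace ℝ (Fin 3))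
    {u₁ : EuclideanSpace ℝ (Fin 3)} (hu₁ : u₁ ∈ fccSlots)
    (hsteep₁ : Real.sqrt 2 / 2 ≤ ⟪A₁ u₁, EuclideanSpace.single (2 : Fin 3) (1 : ℝ)⟫_ℝ)
    {u₂ : EuclideanSpace ℝ (Fin 3)} (hu₂ : u₂ ∈ fccSlots)
    (hsteep₂ : ⟪A₂ u₂, EuclideanSpace.single (2 : Fin 3) (1 : ℝ)⟫_ℝ ≤ -(Real.sqrt 2 / 2))
    (μk μk1 : EuclideanSpace ℝ (Fin 3))
    (hκl : ∀ μ ∈ [μk, μk1], ‖μ‖ = 1 ∧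
      ∀ w ∈ fccSlots, ⟪w, μ⟫_ℝ = 0 ∨ ⟪w, μ⟫_ℝ = Real.sqrt (2 / 3) ∨ ⟪w, μ⟫_ℝ = -Real.sqrt (2 / 3))
    (hκc : List.IsChain (fun μ μ' => ⟪μ, μ'⟫_ℝ = 1 / 3 ∨ ⟪μ, μ'⟫_ℝ = -1 / 3) [μk, μk1])
    (hA₂ : A₂ '' fccStacking 1 (Real.sqrt (2 / 3)) = (wordFrame A₁ [μk, μk1]) '' fccStacking 1 (Real.sqrt (2 / 3)))
    (hfirst : ⟪u₁, μk1⟫_ℝ = 0)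
    (hsecond : ∀ n₁ : EuclideanSpace ℝ (Fin 3),
      (n₁ = wordFrame A₁ [μk, μk1] μk ∨ n₁ = -wordFrame A₁ [μk, μk1] μk) → ⟪A₂ u₂, n₁⟫_ℝ = Real.sqrt (2 / 3) →
      ∀ q ∈ fccSlots, 0 < ⟪twinFrame A₂ n₁ q, n₁⟫_ℝ →
        (∀ q' ∈ fccSlots, 0 < ⟪twinFrame A₂ n₁ q', n₁⟫_ℝ →
          ⟪twinFrame A₂ n₁ q', -EuclideanSpace.single (2 : Fin 3) (1 : ℝ)⟫_ℝ ≤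
            ⟪twinFrame A₂ n₁ q, -EuclideanSpace.single (2 : Fin 3) (1 : ℝ)⟫_ℝ) →
        (wordFrame A₁ [μk, μk1]).symm (A₂ ((twinFrame A₂ n₁).symm ((2 * Real.sqrt (2 / 3)) • twinFrame A₂ n₁ q - n₁))) ≠ μk1 ∧
        (wordFrame A₁ [μk, μk1]).symm (A₂ ((twinFrame A₂ n₁).symm ((2 * Real.sqrt (2 / 3)) • twinFrame A₂ n₁ q - n₁))) ≠ -μk1)
    (hcap : ∀ n₁ : EuclideanSpace ℝ (Fin 3),
      (n₁ = wordFrame A₁ [μk, μk1] μk ∨ n₁ = -wordFrame A₁ [μk, μk1] μk) → ⟪A₂ u₂, n₁⟫_ℝ = Real.sqrt (2 / 3) →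
      ∀ q ∈ fccSlots, 0 < ⟪twinFrame A₂ n₁ q, n₁⟫_ℝ →
        (∀ q' ∈ fccSlots, 0 < ⟪twinFrame A₂ n₁ q', n₁⟫_ℝ →
          ⟪twinFrame A₂ n₁ q', -EuclideanSpace.single (2 : Fin 3) (1 : ℝ)⟫_ℝ ≤
            ⟪twinFrame A₂ n₁ q, -EuclideanSpace.single (2 : Fin 3) (1 : ℝ)⟫_ℝ) →
        ⟪twinFrame A₂ n₁ q, A₁ μk1⟫_ℝ = 0) :
    GenericWallFloorAtCharge 1 A₁ t₁ A₂ t₂ :=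
  genericWallFloorAtCharge_one_sigma9_of_far hs₀ hcert hfar inPlaneTwinStarPair_holds A₁ t₁ A₂ t₂ hu₁ hsteep₁ hu₂
    hsteep₂ μk μk1 hκl hκc hA₂ hfirst hsecond hcap

open scoped Classical in
/-- **`GenericWallFloor` per pair at FULL charge on the mirrored one-sided `Σ9` class (upper grain in-plane)**, modulo
`ExactOnly`(C12-55) and `StarPairFar` only. -/
theorem genericWallFloorAtCharge_one_sigma9Down
    {s₀ : EuclideanSpace ℝ (Fin 3)} (hs₀ : s₀ ∈ fccSlots)
    (hcert : ExactOnly 0 (fccSlots.filter fun w => 0 < ⟪w, s₀⟫_ℝ)) (hfar : StarPairFar)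
    (A₁ : EuclideanSpace ℝ (Fin 3) ≃ₗᵢ[ℝ] EuclideanSpace ℝ (Fin 3)) (t₁ : EuclideanSpace ℝ (Fin 3))
    (A₂ : EuclideanSpace ℝ (Fin 3) ≃ₗᵢ[ℝ] EuclideanSpace ℝ (Fin 3)) (t₂ : EuclideanSpace ℝ (Fin 3))
    {u₁ : EuclideanSpace ℝ (Fin 3)} (hu₁ : u₁ ∈ fccSlots)
    (hsteep₁ : Real.sqrt 2 / 2 ≤ ⟪A₁ u₁, EuclideanSpace.single (2 : Fin 3) (1 : ℝ)⟫_ℝ)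
    {u₂ : EuclideanSpace ℝ (Fin 3)} (hu₂ : u₂ ∈ fccSlots)
    (hsteep₂ : ⟪A₂ u₂, EuclideanSpace.single (2 : Fin 3) (1 : ℝ)⟫_ℝ ≤ -(Real.sqrt 2 / 2))
    (μk μk1 : EuclideanSpace ℝ (Fin 3))
    (hκl : ∀ μ ∈ [μk, μk1], ‖μ‖ = 1 ∧
      ∀ w ∈ fccSlots, ⟪w, μ⟫_ℝ = 0 ∨ ⟪w, μ⟫_ℝ = Real.sqrt (2 / 3) ∨ ⟪w, μ⟫_ℝ = -Real.sqrt (2 / 3))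
    (hκc : List.IsChain (fun μ μ' => ⟪μ, μ'⟫_ℝ = 1 / 3 ∨ ⟪μ, μ'⟫_ℝ = -1 / 3) [μk, μk1])
    (hA₁ : A₁ '' fccStacking 1 (Real.sqrt (2 / 3)) = (wordFrame A₂ [μk, μk1]) '' fccStacking 1 (Real.sqrt (2 / 3)))
    (hfirst : ⟪u₂, μk1⟫_ℝ = 0)
    (hsecond : ∀ n₁ : EuclideanSpace ℝ (Fin 3),
      (n₁ = wordFrame A₂ [μk, μk1] μk ∨ n₁ = -wordFrame A₂ [μk, μk1] μk) → ⟪A₁ u₁, n₁⟫_ℝ = Real.sqrt (2 / 3) →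
      ∀ q ∈ fccSlots, 0 < ⟪twinFrame A₁ n₁ q, n₁⟫_ℝ →
        (∀ q' ∈ fccSlots, 0 < ⟪twinFrame A₁ n₁ q', n₁⟫_ℝ →
          ⟪twinFrame A₁ n₁ q', EuclideanSpace.single (2 : Fin 3) (1 : ℝ)⟫_ℝ ≤
            ⟪twinFrame A₁ n₁ q, EuclideanSpace.single (2 : Fin 3) (1 : ℝ)⟫_ℝ) →
        (wordFrame A₂ [μk, μk1]).symm (A₁ ((twinFrame A₁ n₁).symm ((2 * Real.sqrt (2 / 3)) • twinFrame A₁ n₁ q - n₁))) ≠ μk1 ∧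
        (wordFrame A₂ [μk, μk1]).symm (A₁ ((twinFrame A₁ n₁).symm ((2 * Real.sqrt (2 / 3)) • twinFrame A₁ n₁ q - n₁))) ≠ -μk1)
    (hcap : ∀ n₁ : EuclideanSpace ℝ (Fin 3),
      (n₁ = wordFrame A₂ [μk, μk1] μk ∨ n₁ = -wordFrame A₂ [μk, μk1] μk) → ⟪A₁ u₁, n₁⟫_ℝ = Real.sqrt (2 / 3) →
      ∀ q ∈ fccSlots, 0 < ⟪twinFrame A₁ n₁ q, n₁⟫_ℝ →
        (∀ q' ∈ fccSlots, 0 < ⟪twinFrame A₁ n₁ q', n₁⟫_ℝ →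
          ⟪twinFrame A₁ n₁ q', EuclideanSpace.single (2 : Fin 3) (1 : ℝ)⟫_ℝ ≤
            ⟪twinFrame A₁ n₁ q, EuclideanSpace.single (2 : Fin 3) (1 : ℝ)⟫_ℝ) →
        ⟪twinFrame A₁ n₁ q, A₂ μk1⟫_ℝ = 0) :
    GenericWallFloorAtCharge 1 A₁ t₁ A₂ t₂ :=
  genericWallFloorAtCharge_one_sigma9Down_of_far hs₀ hcert hfar inPlaneTwinStarPair_holds A₁ t₁ A₂ t₂ hu₁ hsteep₁ hu₂
    hsteep₂ μk μk1 hκl hκc hA₁ hfirst hsecond hcap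

end Summit.Ventures.Crystal3D.Theorems

end
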